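import Summits.AtomisticToContinuum.Crystallization.Theorems.ChartedZeroExcessLayeredLatticeLiouvilleYO

/-!
# Charted zero-excess layered-lattice Liouville — YP «TubeTameness»: the kinematic half of the tube reference (XR), PROVED (lens-2 g68, addendum 1)

Part YO typed the existence leaf (QE) as (XR) `TubeReferenceP` ∧ (X1) `TubeConvexityP` ∧ (X2ᴸ) `LoadedTubeAprioriP` and proved the glue.  (XR) asks for a
reference filling `y₀` such that EVERY member `z` of its vector bond tube `bondTube X Rg sb dI dB y₀` is `ϑ`-tame at every site w.r.t. `X ∪ range z`
(`IsTubeReference`).  This part proves the BOOKKEEPING behind the budget `ϑ ≥ ϑ₀ + max(sb, dI)`, `Rg ≥ 4 + 2·dB` announced in YO: the tameness clause of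
`IsTubeReference` follows from an `R'`-EXTENDED `ϑ₀`-tameness of the reference ALONE (`R' ≥ 4 + 2·dB`), member by member, with the SAME rotation and the model
map transported along `y₀ ↦ z`.

* `IsTameStarR R ϑ S H x` — the `R`-star version of `IsTameStar` (`IsTameStarR 4 = IsTameStar`, `isTameStarR_four_iff`); antitone in `R`, monotone in `ϑ`.
* ★★ `isTameStar_of_mem_bondTube` (PROVED): `z ∈ bondTube X Rg sb dI dB y₀`, `z` injective, `range z` disjoint from `X`, `0 ≤ dB`, `4 + 2·dB ≤ Rg`,
  `4 + 2·dB ≤ R'`, and the reference star at `y₀ i` is `(R', ϑ₀)`-tame w.r.t. `X ∪ range y₀` ⟹ the star of `z` at `z i` is `(ϑ₀ + max sb dI)`-tame w.r.t.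
  `X ∪ range z`.  Proof: keep `U`; transport `g` (`g' (z j) := g (y₀ j)`, `g' = g` on `X`); a core–core `4`-bond of `z` is an `Rg`-bond of `y₀` (bulk pins,
  `4 + 2·dB ≤ Rg`) so its vector deviates by `≤ sb`; a core–exterior `4`-bond makes `i` an interface site (`4 + dB ≤ Rg`) so `z i` moved by `≤ dI`; `U` is an
  isometry.
* `isTameStar_tube_of_reference` (PROVED): the sitewise corollary for all `i` at any `ϑ ≥ ϑ₀ + max sb dI` — the tameness clause of `IsTubeReference` is thereby
  reduced to (a) extended tameness of `y₀`, (b) injectivity and `X`-avoidance of members (metric separation facts of the tube: `sb`/`dI`/`dB` against the hard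
  core of `X` and the spacing of `y₀`), (c) the matching `dist (xf i) (z i) ≤ dm` (triangle: `dist (xf i) (y₀ i) + dB ≤ dm`, `dist_matched_of_mem_bondTube`).
0 sorry; standard axioms; 1 `def` predicate + 8 theorems.
-/

noncomputable section

open scoped BigOperators Classical
open MeasureTheory Set Metric Filter Topology
open Summit.AtomisticToContinuum.Crystallization.Theorems.ChartedPlanarOrderRigidityDoor (E3)

namespace Summit.AtomisticToContinuum.Crystallization.Theorems.ChartedZeroExcessLayeredLatticeLiouville

/-! ## Part YP «TubeTameness» (lens-2 g68, addendum 1): tameness of tube members from extended tameness of the reference -/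

section TubeTameness

variable {n : ℕ}

/-- **`IsTameStarR R ϑ S H x`** — the `R`-STAR of `S` at `x` is `ϑ`-tame relative to `H`: `IsTameStar` with the star radius `4` replaced by `R` (a rotation `U`
of determinant `1` and a model map `g` of `S ∩ closedBall x R` into `H` matching every `R`-bond within `ϑ`).  Used at `R = 4 + 2·dB` for the REFERENCE filling,
whose witnesses must cover the slightly larger stars that tube members can see. [this file, g68] -/
def IsTameStarR (R ϑ : ℝ) (S H : Set E3) (x : E3) : Prop :=
  ∃ (U : E3 ≃ₗᵢ[ℝ] E3) (g : E3 → E3), LinearMap.det (U.toLinearEquiv : E3 →ₗ[ℝ] E3) = 1 ∧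
    MapsTo g (S ∩ closedBall x R) H ∧ ∀ p ∈ S, dist p x ≤ R → dist (U (p - x)) (g p - g x) ≤ ϑ

/-- the `4`-star version is `IsTameStar` itself. [this file, g68] -/
theorem isTameStarR_four_iff {ϑ : ℝ} {S H : Set E3} {x : E3} : IsTameStarR 4 ϑ S H x ↔ IsTameStar ϑ S H x := Iff.rfl

/-- extended tameness is antitone in the radius and monotone in the threshold. [this file, g68] -/
theorem IsTameStarR.mono {R R' ϑ ϑ' : ℝ} (hR : R' ≤ R) (hϑ : ϑ ≤ ϑ') {S H : Set E3} {x : E3} (hx : IsTameStarR R ϑ S H x) :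
    IsTameStarR R' ϑ' S H x := by
  obtain ⟨U, g, hU, hg, hb⟩ := hx
  refine ⟨U, g, hU, fun p hp => hg ⟨hp.1, ?_⟩, fun p hp hpx => (hb p hp (hpx.trans hR)).trans hϑ⟩
  have : dist p x ≤ R' := hp.2
  exact this.trans hR

/-- an extended-tame star is tame (`4 ≤ R`). [this file, g68] -/
theorem IsTameStarR.isTameStar {R ϑ : ℝ} (hR : 4 ≤ R) {S H : Set E3} {x : E3} (hx : IsTameStarR R ϑ S H x) : IsTameStar ϑ S H x :=
  isTameStarR_four_iff.1 (hx.mono hR le_rfl)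

variable {X H : Set E3} {Rg sb dI dB : ℝ} {y₀ z : Fin n → E3}

/-- in the bond tube, a `4`-bond of a member is a `(4 + 2·dB)`-bond of the reference. [this file, g68] -/
theorem dist_ref_le_of_dist_le_four (hz : z ∈ bondTube X Rg sb dI dB y₀) {i j : Fin n} (h : dist (z j) (z i) ≤ 4) :
    dist (y₀ j) (y₀ i) ≤ 4 + 2 * dB := by
  have hj : dist (z j) (y₀ j) ≤ dB := hz.2.2 j
  have hi : dist (z i) (y₀ i) ≤ dB := hz.2.2 i
  calc dist (y₀ j) (y₀ i) ≤ dist (y₀ j) (z j) + dist (z j) (y₀ i) := dist_triangle _ _ _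
    _ ≤ dist (y₀ j) (z j) + (dist (z j) (z i) + dist (z i) (y₀ i)) := by gcongr; exact dist_triangle _ _ _
    _ ≤ dB + (4 + dB) := by rw [dist_comm (y₀ j)]; gcongr
    _ = 4 + 2 * dB := by ring

/-- in the bond tube, the matching radius is the reference's matching radius plus the bulk pin. [this file, g68] -/
theorem dist_matched_of_mem_bondTube {xf : Fin n → E3} {d dm : ℝ} (hz : z ∈ bondTube X Rg sb dI dB y₀) (hd : ∀ i, dist (xf i) (y₀ i) ≤ d)
    (hdm : d + dB ≤ dm) (i : Fin n) : dist (xf i) (z i) ≤ dm :=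
  calc dist (xf i) (z i) ≤ dist (xf i) (y₀ i) + dist (y₀ i) (z i) := dist_triangle _ _ _
    _ ≤ d + dB := by rw [dist_comm (y₀ i)]; exact add_le_add (hd i) (hz.2.2 i)
    _ ≤ dm := hdm

/-- ★★ **TUBE TAMENESS BOOKKEEPING (PROVED)** — the kinematic half of (XR).  If the reference star at `y₀ i` is `(R', ϑ₀)`-tame w.r.t. `X ∪ range y₀` with
`R' ≥ 4 + 2·dB`, and `Rg ≥ 4 + 2·dB`, then for every member `z` of `bondTube X Rg sb dI dB y₀` that is injective and avoids `X`, the star at `z i` is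
`(ϑ₀ + max sb dI)`-tame w.r.t. `X ∪ range z`: the same rotation `U`, the model map transported along `y₀ ↦ z`; core–core `4`-bonds deviate by `≤ sb` (they
are `Rg`-bonds of the reference), core–exterior `4`-bonds by `≤ dI` (their core end is an interface site). [this file, g68] -/
theorem isTameStar_of_mem_bondTube {ϑ₀ R' : ℝ} (hdB : 0 ≤ dB) (hRg : 4 + 2 * dB ≤ Rg) (hR' : 4 + 2 * dB ≤ R')
    (hz : z ∈ bondTube X Rg sb dI dB y₀) (hinj : Function.Injective z) (hdisj : Disjoint (Set.range z) X) {i : Fin n}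
    (href : IsTameStarR R' ϑ₀ (X ∪ Set.range y₀) H (y₀ i)) :
    IsTameStar (ϑ₀ + max sb dI) (X ∪ Set.range z) H (z i) := by
  obtain ⟨U, g, hU, hg, hb⟩ := href
  -- the transported model map: `g' (z j) = g (y₀ j)`, `g' = g` off `range z`
  let g' : E3 → E3 := fun p => if h : p ∈ Set.range z then g (y₀ (Classical.choose h)) else g p
  have hg'z : ∀ j, g' (z j) = g (y₀ j) := by
    intro j
    have h : z j ∈ Set.range z := ⟨j, rfl⟩
    have hc : Classical.choose h = j := hinj (Classical.choose_spec h)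
    simp only [g', dif_pos h, hc]
  have hg'X : ∀ p ∈ X, g' p = g p := by
    intro p hp
    have h : p ∉ Set.range z := fun h => (Set.disjoint_right.1 hdisj hp) h
    simp only [g', dif_neg h]
  have hRg' : 4 + dB ≤ Rg := by linarith
  have hR'' : 4 + dB ≤ R' := by linarith
  refine ⟨U, g', hU, ?_, ?_⟩
  · -- `g'` maps the `4`-star of `z i` in `X ∪ range z` into `H`
    rintro p ⟨hp, hp4⟩
    have hp4' : dist p (z i) ≤ 4 := hp4
    rcases hp with hpX | ⟨j, rfl⟩
    · rw [hg'X p hpX]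
      refine hg ⟨Or.inl hpX, ?_⟩
      show dist p (y₀ i) ≤ R'
      calc dist p (y₀ i) ≤ dist p (z i) + dist (z i) (y₀ i) := dist_triangle _ _ _
        _ ≤ 4 + dB := add_le_add hp4' (hz.2.2 i)
        _ ≤ R' := hR''
    · rw [hg'z j]
      refine hg ⟨Or.inr ⟨j, rfl⟩, ?_⟩
      show dist (y₀ j) (y₀ i) ≤ R'
      exact (dist_ref_le_of_dist_le_four hz hp4').trans hR'
  · -- the bond estimates
    intro p hp hp4
    rcases hp with hpX | ⟨j, rfl⟩
    · -- core–exterior bond: `i` is an interface site, `z i` moved by `≤ dI`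
      have hpy : dist p (y₀ i) ≤ 4 + dB :=
        calc dist p (y₀ i) ≤ dist p (z i) + dist (z i) (y₀ i) := dist_triangle _ _ _
          _ ≤ 4 + dB := add_le_add hp4 (hz.2.2 i)
      have hint : dist (z i) (y₀ i) ≤ dI := hz.2.1 i ⟨p, hpX, by rw [dist_comm]; exact hpy.trans hRg'⟩
      have href' : dist (U (p - y₀ i)) (g p - g (y₀ i)) ≤ ϑ₀ := hb p (Or.inl hpX) (hpy.trans hR'')
      rw [hg'X p hpX, hg'z i]
      calc dist (U (p - z i)) (g p - g (y₀ i))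
          ≤ dist (U (p - z i)) (U (p - y₀ i)) + dist (U (p - y₀ i)) (g p - g (y₀ i)) := dist_triangle _ _ _
        _ = dist (z i) (y₀ i) + dist (U (p - y₀ i)) (g p - g (y₀ i)) := by rw [U.dist_map, dist_sub_left]
        _ ≤ dI + ϑ₀ := add_le_add hint href'
        _ ≤ ϑ₀ + max sb dI := by linarith [le_max_right sb dI]
    · -- core–core bond: an `Rg`-bond of the reference, vector deviation `≤ sb`
      have hyy : dist (y₀ j) (y₀ i) ≤ 4 + 2 * dB := dist_ref_le_of_dist_le_four hz hp4
      have hbond : dist (z j - z i) (y₀ j - y₀ i) ≤ sb := hz.1 j i (hyy.trans hRg)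
      have href' : dist (U (y₀ j - y₀ i)) (g (y₀ j) - g (y₀ i)) ≤ ϑ₀ := hb (y₀ j) (Or.inr ⟨j, rfl⟩) (hyy.trans hR')
      rw [hg'z j, hg'z i]
      calc dist (U (z j - z i)) (g (y₀ j) - g (y₀ i))
          ≤ dist (U (z j - z i)) (U (y₀ j - y₀ i)) + dist (U (y₀ j - y₀ i)) (g (y₀ j) - g (y₀ i)) := dist_triangle _ _ _
        _ = dist (z j - z i) (y₀ j - y₀ i) + dist (U (y₀ j - y₀ i)) (g (y₀ j) - g (y₀ i)) := by rw [U.dist_map]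
        _ ≤ sb + ϑ₀ := add_le_add hbond href'
        _ ≤ ϑ₀ + max sb dI := by linarith [le_max_left sb dI]

/-- **COROLLARY (PROVED): the tameness clause of `IsTubeReference` from extended tameness of the reference** — at any budget `ϑ ≥ ϑ₀ + max sb dI`, every
injective `X`-avoiding member of the tube is `ϑ`-tame at every site. [this file, g68] -/
theorem isTameStar_tube_of_reference {ϑ₀ ϑ R' : ℝ} (hdB : 0 ≤ dB) (hRg : 4 + 2 * dB ≤ Rg) (hR' : 4 + 2 * dB ≤ R') (hϑ : ϑ₀ + max sb dI ≤ ϑ)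
    (href : ∀ i, IsTameStarR R' ϑ₀ (X ∪ Set.range y₀) H (y₀ i))
    (hz : z ∈ bondTube X Rg sb dI dB y₀) (hinj : Function.Injective z) (hdisj : Disjoint (Set.range z) X) (i : Fin n) :
    IsTameStar ϑ (X ∪ Set.range z) H (z i) :=
  (isTameStar_of_mem_bondTube hdB hRg hR' hz hinj hdisj (href i)).mono hϑ

/-- **THE INSTANCE BUDGET (PROVED)**: at the YO dial instance `ϑ₀ = 1/400`, `(sb, dI, dB) = (3/400, 3/400, 3/10)`, `Rg = R' = 5`: `4 + 2·(3/10) ≤ 5` and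
`1/400 + max (3/400) (3/400) ≤ 1/100`. [this file, g68] -/
theorem tubeTameness_budget_instance : (4 : ℝ) + 2 * (3 / 10) ≤ 5 ∧ (1 : ℝ) / 400 + max (3 / 400) (3 / 400) ≤ 1 / 100 := by
  refine ⟨by norm_num, ?_⟩
  rw [max_self]; norm_num

end TubeTameness

end Summit.AtomisticToContinuum.Crystallization.Theorems.ChartedZeroExcessLayeredLatticeLiouville

end
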